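import Summits.Ventures.PercRepro.SixFourResidueClausesThree
import Summits.Ventures.PercRepro.SixFourResidueThreeSmallClause

/-!
# PercRepro — C-025 at `(6,4)`: the `g ≤ 9` clause at `t = 3` is discharged (p3, gen 11)

p2's `J_three_nonneg_of_card_le_nine` (`SixFourResidueThreeSmallClause.lean`: `0 ≤ J₃(G)` for every rank-`4` set
`G ⊆ E` of a simple matroid with at most `9` points — the §21.18.1 trichotomy at `t = 3`) is exactly `TypeThreeSmall`
of `SixFourResidueClausesThree.lean`.  Hence **`typeThreeSmall_holds`**, and the type-`3` clause of the residue reduces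
to Theorem 21′ alone (**`typeThreeClause_of_twentyOnePrime : TwentyOnePrime → TypeThreeClause`**); with the big-plane
clause, `SixFourResidue` reads `TwentyOnePrime ∧ BigPlaneClause` (`sixFourResidue_of_twentyOnePrime_bigPlane`) and
C-025 at `(6,4)` on every finite matroid follows from the two named `Prop`s `TwentyOnePrime` and `TwentyTwoPrime`
(**`rls_six_four_of_two_primes`**).
-/

namespace PercRepro.SixFour

open Finset ThmH PerFlat ThmN

/-- **The `g ≤ 9` clause at `t = 3` holds** (p2's `J_three_nonneg_of_card_le_nine`). -/
theorem typeThreeSmall_holds : TypeThreeSmall := by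
  intro β _ M _ G hs hG hr hg
  exact J_three_nonneg_of_card_le_nine hs hG hr hg

/-- **The type-`3` clause from Theorem 21′ alone.** -/
theorem typeThreeClause_of_twentyOnePrime (h3b : TwentyOnePrime) : TypeThreeClause :=
  typeThreeClause_of typeThreeSmall_holds h3b

/-- **`SixFourResidue` from Theorem 21′ and the big-plane clause.** -/
theorem sixFourResidue_of_twentyOnePrime_bigPlane (h3b : TwentyOnePrime) (h4b : BigPlaneClause) : SixFourResidue :=
  sixFourResidue_of_three_clauses typeThreeSmall_holds h3b h4b

/-- **C-025 at `(6, 4)` on every finite matroid from Theorem 21′ and the big-plane clause**: `RLS M 6 4`. -/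
theorem rls_six_four_of_twentyOnePrime_bigPlane {α : Type} (h3b : TwentyOnePrime) (h4b : BigPlaneClause)
    (M : Matroid α) [M.Finite] : RLS M 6 4 :=
  rls_six_four_of_residue (sixFourResidue_of_twentyOnePrime_bigPlane h3b h4b) M

/-- **C-025 at `(6, 4)` on every finite matroid from the two named `Prop`s of record**, `TwentyOnePrime` (`t = 3`)
and `TwentyTwoPrime` (`t = 4`). -/
theorem rls_six_four_of_two_primes {α : Type} (h3b : TwentyOnePrime) (h4 : TwentyTwoPrime) (M : Matroid α)
    [M.Finite] : RLS M 6 4 :=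
  rls_six_four_of_primes typeThreeSmall_holds h3b h4 M

end PercRepro.SixFour
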